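import Summits.QuantumFields.YangMills.Theorems.LuscherReductionTraceDoorGlue
import Summits.QuantumFields.YangMills.Theorems.LuscherReductionTraceFormulaClosed
import Summits.QuantumFields.YangMills.Theorems.LuscherReductionRunningReductionOneSiteTailClosed
import HarnessLib

/-!
# RED `RunningReduction` from its two XL children alone: `TwistedTraceScaling → DressedRitz → RunningReduction`

Route `LuscherReduction` (owner ym-beyond-p1), RED `RunningReduction` (stmt-QuantumFields-19978) split (route rev 11/12) along the TT door
into `TraceFormula` (20202) · `TwistedTraceScaling` (20203) · `OneSiteTail` (20204) · `DressedRitz` (20205) with glue `TraceDoorGlue` (20206).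
With the two M children CLOSED in the tree — `TT.traceFormula_proof` (p512172, `Theorems/LuscherReductionTraceFormulaClosed.lean`) and
`OST.oneSiteTail_proof` (p516856, `Theorems/LuscherReductionRunningReductionOneSiteTailClosed.lean`, seat ym-luscher-20007-p1) — and the glue
`TraceDoor.traceDoorGlue_proof` (`Theorems/LuscherReductionTraceDoorGlue.lean`), the parent crux RED rests on EXACTLY its two XL children:

* `runningReduction_of_twistedTraceScaling_dressedRitz : TwistedTraceScaling → DressedRitz → RunningReduction`;
* `coarseLevels_of_twistedTraceScaling : TwistedTraceScaling → ⟨CoarseLevels text⟩` — the coarse two-sided Lüscher law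
  `e^{−(Δ_k+η)λ/L} λ_0 ≤ λ_k ≤ e^{−(Δ_k−η)λ/L} λ_0` for EVERY level, from the RG trace statement alone (no `DressedRitz`);
(The unconditional OSTL text — registered stub `stub_oneSiteTraceLimit` of line «twolattice» on 20203 — is already the tree's
`TraceDoor.oneSiteTraceLimit`, `Theorems/LuscherReductionTwistedTraceScalingOneSiteTraceLimit.lean`, via this family's
`oneSiteTraceLimit_of_oneSiteTail`; not repeated here.)

HONEST FRAMING: conditional bookkeeping of the femto rung R2b1 — `TwistedTraceScaling` (THE RG statement, XL) and `DressedRitz` (XL/L) are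
HYPOTHESES; nothing here is infinite volume, continuum, a mass gap or Clay.  Sorry-free, no new definitions.
-/

set_option autoImplicit false

noncomputable section

namespace Summit.QuantumFields.YangMills.Theorems.FemtoTransferGap.TraceDoor

open Summit.QuantumFields.YangMills.Theorems.FemtoTransferGap


/-- ★ **RED from its two XL children**: `TwistedTraceScaling → DressedRitz → RunningReduction` (the glue `traceDoorGlue_proof` fed with the
closed children `TT.traceFormula_proof` and `OST.oneSiteTail_proof`). [cite: Luscher1983, §3] [cite: LuscherMunster1984] -/
theorem runningReduction_of_twistedTraceScaling_dressedRitz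
    (hTS : Summit.QuantumFields.YangMills.Theses.LuscherReduction.TwistedTraceScaling)
    (hDR : Summit.QuantumFields.YangMills.Theses.LuscherReduction.DressedRitz) :
    Summit.QuantumFields.YangMills.Theses.LuscherReduction.RunningReduction :=
  traceDoorGlue_proof Summit.QuantumFields.YangMills.Theorems.FemtoTransferGap.TT.traceFormula_proof hTS
    Summit.QuantumFields.YangMills.Theorems.FemtoTransferGap.OST.oneSiteTail_proof hDR

/-- ★ **The coarse two-sided Lüscher law for every level from `TwistedTraceScaling` alone** (`TraceFormula`, `OneSiteTail` closed;
`DressedRitz` not needed): for every `k` and `η > 0`, eventually in the femto window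
`e^{−(Δ_k+η)λ/L} λ_0 ≤ λ_k ≤ e^{−(Δ_k−η)λ/L} λ_0`. [cite: Luscher1983, §1] [cite: Feller1971, XIII.1 Thm 2a] -/
theorem coarseLevels_of_twistedTraceScaling
    (hTS : Summit.QuantumFields.YangMills.Theses.LuscherReduction.TwistedTraceScaling) :
    (∀ k : ℕ, ∀ η : ℝ, 0 < η → ∃ lam0 : ℝ, 0 < lam0 ∧ ∀ lam : ℝ, 0 < lam → lam ≤ lam0 →
      ∃ L0 : ℕ, ∀ (L : ℕ) [NeZero L], L0 ≤ L → ∀ β : ℝ, InFemtoWindow lam β L →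
        Real.exp (-((levelGap k + η) * luscherLambda β L) / L) * levelValue su2Rep L β 0 ≤ levelValue su2Rep L β k ∧
          levelValue su2Rep L β k ≤ Real.exp (-((levelGap k - η) * luscherLambda β L) / L) * levelValue su2Rep L β 0) :=
  coarseLevels_of_children Summit.QuantumFields.YangMills.Theorems.FemtoTransferGap.TT.traceFormula_proof hTS
    Summit.QuantumFields.YangMills.Theorems.FemtoTransferGap.OST.oneSiteTail_proof

end Summit.QuantumFields.YangMills.Theorems.FemtoTransferGap.TraceDoor

end
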